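import Summits.NavierStokesRegularity.OSWSelfSimilar.SheetRComplexPivot
import Mathlib.Analysis.Distribution.AEEqOfIntegralContDiff
import Mathlib.MeasureTheory.Group.Integral
import HarnessLib

/-!
# SHEET-ℝ frame: the ODD CLASS of the pivot spaces `L²_w(ℝ)` / `L²_w(ℂ)` as closed subspaces, and the density lemma
# «odd `g ∈ L²_w` orthogonal to every compactly supported odd energy-class test is zero»

HONEST FRAMING (cell ns-blowup GROUP B / zone Z3, case Z3-SR-SPEC, PAPER item (P1); 1-D MODEL certificate frame (viscous gCLM/OSW sheet on the
line); not Euler/NS; «violates: none — MODEL»). Nothing here asserts that a profile exists.  This file supplies the two inputs the KERNEL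
CAVEAT of `SheetRResolventComplex` / `SheetRPerturbedResolvent(C)` asks for («tests are odd ⇒ `R(σ)` is THE resolvent on the odd class and only
a pseudo-resolvent on all of `L²_w(ℂ)`»): the odd class as a Banach space and the injectivity ingredient.

* `measurePreserving_neg` — the reflection `ξ ↦ −ξ` preserves the weighted measure `μw L = (L² + ξ²)dξ` (even weight);
* `reflW L : W L →L[ℝ] W L`, `reflWc L : Wc L →L[ℂ] Wc L` — composition with the reflection (linear isometries of `Lp`), involutive;
* `Wodd L := ker(1 + reflW L)`, `Wcodd L := ker(1 + reflWc L)` — the ODD CLASSES, closed submodules (`isClosed_Wodd/Wcodd`, `completeSpace_Wcodd`);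
  `mem_Wodd_iff_ae` (`g ∈ Wodd ↔ g(−ξ) = −g(ξ)` a.e.), `mem_Wcodd_iff` (`G ∈ Wcodd ↔ Re G, Im G ∈ Wodd`), `ofPair_mem_Wcodd`;
* `ιE_mem_Wodd` — energy-space profiles are odd: `ιE p ∈ Wodd`; hence `ofPair (ιpair P) ∈ Wcodd`;
* **`eq_zero_of_mem_Wodd`** — if `g ∈ Wodd L` and `∫ w g v = 0` for every compactly supported odd energy-class test `(v, v₁)`, then `g = 0`
  (odd/even splitting of a smooth bump + Mathlib's `ae_eq_zero_of_integral_contDiff_smul_eq_zero`); `eq_zero_of_mem_Wcodd` — complex version.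
Two bundled maps and two submodules (definitions); no named fact.  WHAT THIS IS NOT: not NS; no number of record moves.
-/

noncomputable section

namespace Summit.NavierStokesRegularity.OSWSelfSimilar
namespace SheetROddClass

open _root_.MeasureTheory _root_.Set _root_.Filter _root_.Real SheetRWeakProfilePV SheetRWeakToStrong SheetREnergyClass SheetRWeightedMeasure
  SheetRLinearisedTests SheetREnergySpace SheetRTestSpace SheetRSolutionOperator SheetRComplexPivot
open scoped Topology ENNReal

/-! ### §1 The reflection on the weighted pivot spaces -/

/-- The reflection `ξ ↦ −ξ` preserves `μw L` (the weight `L² + ξ²` is even). [folklore] -/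
theorem measurePreserving_neg (L : ℝ) : MeasurePreserving (Neg.neg : ℝ → ℝ) (μw L) (μw L) := by
  refine ⟨measurable_neg, ?_⟩
  ext s hs
  rw [Measure.map_apply measurable_neg hs, μw_eq, withDensity_apply _ hs, withDensity_apply _ (measurable_neg hs)]
  have h := (Measure.measurePreserving_neg (volume : Measure ℝ)).setLIntegral_comp_preimage hs (measurable_weight L)
  simp only [neg_sq] at h ⊢
  exact h

/-- `μw L ≪ volume`. [folklore] -/
theorem μw_absolutelyContinuous_volume (L : ℝ) : μw L ≪ (volume : Measure ℝ) := by
  rw [μw_eq]; exact withDensity_absolutelyContinuous _ _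

/-- `volume`-a.e. equalities transfer to `μw L`-a.e. equalities. [folklore] -/
theorem ae_μw_of_ae_volume {L : ℝ} {f g : ℝ → ℝ} (h : f =ᵐ[volume] g) : f =ᵐ[μw L] g :=
  (μw_absolutelyContinuous_volume L).ae_eq h

variable (L : ℝ)

/-- **The reflection on `W L = L²_w(ℝ)`**: `g ↦ g ∘ (−·)`. [folklore] -/
def reflW : W L →L[ℝ] W L :=
  (Lp.compMeasurePreservingₗᵢ ℝ (Neg.neg : ℝ → ℝ) (measurePreserving_neg L)).toContinuousLinearMap

/-- `reflW L g = g ∘ (−·)` almost everywhere. [folklore] -/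
theorem reflW_ae (g : W L) : ((reflW L g : W L) : ℝ → ℝ) =ᵐ[μw L] fun y => (g : ℝ → ℝ) (-y) :=
  Lp.coeFn_compMeasurePreserving g (measurePreserving_neg L)

/-- `reflW L g = g ∘ (−·)` Lebesgue-almost everywhere. [folklore] -/
theorem reflW_ae_volume (hL : 0 < L) (g : W L) : ((reflW L g : W L) : ℝ → ℝ) =ᵐ[volume] fun y => (g : ℝ → ℝ) (-y) :=
  ae_volume_of_ae_μw hL (reflW_ae L g)

/-- The reflection is an involution. [folklore] -/
theorem reflW_reflW (g : W L) : reflW L (reflW L g) = g := by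
  refine Lp.ext ?_
  have h1 := reflW_ae L (reflW L g)
  have h2 := (measurePreserving_neg L).quasiMeasurePreserving.ae_eq_comp (reflW_ae L g)
  filter_upwards [h1, h2] with y hy1 hy2
  rw [Function.comp_apply, Function.comp_apply, neg_neg] at hy2
  rw [hy1, hy2]

/-- **The reflection on `Wc L = L²_w(ℂ)`**: `G ↦ G ∘ (−·)`, `ℂ`-linear. [folklore] -/
def reflWc : Wc L →L[ℂ] Wc L :=
  (Lp.compMeasurePreservingₗᵢ ℂ (Neg.neg : ℝ → ℝ) (measurePreserving_neg L)).toContinuousLinearMap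

/-- `reflWc L G = G ∘ (−·)` almost everywhere. [folklore] -/
theorem reflWc_ae (G : Wc L) : ((reflWc L G : Wc L) : ℝ → ℂ) =ᵐ[μw L] fun y => (G : ℝ → ℂ) (-y) :=
  Lp.coeFn_compMeasurePreserving G (measurePreserving_neg L)

/-- Real and imaginary parts commute with the reflection. [folklore] -/
theorem reW_imW_reflWc (G : Wc L) : reW L (reflWc L G) = reflW L (reW L G) ∧ imW L (reflWc L G) = reflW L (imW L G) := by
  have hG := reflWc_ae L G
  constructor
  · refine Lp.ext ?_
    have h1 := reW_ae (reflWc L G)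
    have h2 := reflW_ae L (reW L G)
    have h3 := (measurePreserving_neg L).quasiMeasurePreserving.ae_eq_comp (reW_ae G)
    filter_upwards [h1, h2, h3, hG] with y hy1 hy2 hy3 hy
    rw [Function.comp_apply, Function.comp_apply] at hy3
    rw [hy1, hy2, hy3, hy]
  · refine Lp.ext ?_
    have h1 := imW_ae (reflWc L G)
    have h2 := reflW_ae L (imW L G)
    have h3 := (measurePreserving_neg L).quasiMeasurePreserving.ae_eq_comp (imW_ae G)
    filter_upwards [h1, h2, h3, hG] with y hy1 hy2 hy3 hy
    rw [Function.comp_apply, Function.comp_apply] at hy3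
    rw [hy1, hy2, hy3, hy]

/-! ### §2 The odd classes -/

/-- **The odd class of `L²_w(ℝ)`**: `Wodd L = ker(1 + reflW L) = {g | g(−ξ) = −g(ξ) a.e.}`. [folklore] -/
def Wodd : Submodule ℝ (W L) :=
  LinearMap.ker ((ContinuousLinearMap.id ℝ (W L) + reflW L : W L →L[ℝ] W L) : W L →ₗ[ℝ] W L)

/-- Membership in the odd class: `reflW L g = −g`. [folklore] -/
theorem mem_Wodd_iff (g : W L) : g ∈ Wodd L ↔ reflW L g = -g := by
  rw [Wodd, LinearMap.mem_ker, ContinuousLinearMap.coe_coe,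
    show (ContinuousLinearMap.id ℝ (W L) + reflW L) g = g + reflW L g from rfl, add_comm, add_eq_zero_iff_eq_neg]

/-- Membership in the odd class, a.e. form: `g(−ξ) = −g(ξ)` for Lebesgue-a.e. `ξ`. [folklore] -/
theorem mem_Wodd_iff_ae (hL : 0 < L) (g : W L) :
    g ∈ Wodd L ↔ (fun y => (g : ℝ → ℝ) (-y)) =ᵐ[volume] fun y => -(g : ℝ → ℝ) y := by
  rw [mem_Wodd_iff]
  constructor
  · intro h
    have h1 := reflW_ae_volume L hL g
    have h2 : ((reflW L g : W L) : ℝ → ℝ) =ᵐ[volume] ((-g : W L) : ℝ → ℝ) := by rw [h]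
    have h3 := ae_volume_of_ae_μw hL (Lp.coeFn_neg g)
    filter_upwards [h1, h2, h3] with y hy1 hy2 hy3
    rw [← hy1, hy2, hy3, Pi.neg_apply]
  · intro h
    refine Lp.ext ?_
    have h1 := reflW_ae L g
    have h3 := Lp.coeFn_neg g
    filter_upwards [h1, h3, ae_μw_of_ae_volume (L := L) h] with y hy1 hy3 hy
    rw [hy1, hy, hy3, Pi.neg_apply]

/-- The odd class is closed. [folklore] -/
theorem isClosed_Wodd : IsClosed (Wodd L : Set (W L)) :=
  ContinuousLinearMap.isClosed_ker _

/-- **The odd class of `L²_w(ℂ)`**: `Wcodd L = ker(1 + reflWc L)`, a closed `ℂ`-subspace. [folklore] -/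
def Wcodd : Submodule ℂ (Wc L) :=
  LinearMap.ker ((ContinuousLinearMap.id ℂ (Wc L) + reflWc L : Wc L →L[ℂ] Wc L) : Wc L →ₗ[ℂ] Wc L)

/-- Membership in the complex odd class: `reflWc L G = −G`. [folklore] -/
theorem mem_Wcodd_iff_refl (G : Wc L) : G ∈ Wcodd L ↔ reflWc L G = -G := by
  rw [Wcodd, LinearMap.mem_ker, ContinuousLinearMap.coe_coe,
    show (ContinuousLinearMap.id ℂ (Wc L) + reflWc L) G = G + reflWc L G from rfl, add_comm, add_eq_zero_iff_eq_neg]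

/-- Membership in the complex odd class: both real and imaginary parts are in the real odd class. [folklore] -/
theorem mem_Wcodd_iff (G : Wc L) : G ∈ Wcodd L ↔ reW L G ∈ Wodd L ∧ imW L G ∈ Wodd L := by
  rw [mem_Wcodd_iff_refl, mem_Wodd_iff, mem_Wodd_iff]
  obtain ⟨hre, him⟩ := reW_imW_reflWc L G
  constructor
  · intro h
    rw [← hre, ← him, h, map_neg, map_neg]
    exact ⟨rfl, rfl⟩
  · rintro ⟨h1, h2⟩
    rw [← ofPair_toPair (reflWc L G), ← ofPair_toPair (-G)]
    congr 1
    refine WithLp.ofLp_injective 2 (Prod.ext ?_ ?_)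
    · show (toPair L (reflWc L G)).fst = (toPair L (-G)).fst
      rw [(toPair_fst_snd _).1, (toPair_fst_snd _).1, hre, h1, map_neg]
    · show (toPair L (reflWc L G)).snd = (toPair L (-G)).snd
      rw [(toPair_fst_snd _).2, (toPair_fst_snd _).2, him, h2, map_neg]

/-- The complex odd class is closed. [folklore] -/
theorem isClosed_Wcodd : IsClosed (Wcodd L : Set (Wc L)) :=
  ContinuousLinearMap.isClosed_ker _

/-- The complex odd class is a Banach space. [folklore] -/
theorem completeSpace_Wcodd : CompleteSpace (Wcodd L) :=
  (isClosed_Wcodd L).completeSpace_coe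

/-- `ofPair (g_R, g_I) ∈ Wcodd` when `g_R, g_I ∈ Wodd`. [folklore] -/
theorem ofPair_mem_Wcodd {P : WithLp 2 (W L × W L)} (h1 : P.fst ∈ Wodd L) (h2 : P.snd ∈ Wodd L) : ofPair L P ∈ Wcodd L := by
  rw [mem_Wcodd_iff, ← (toPair_fst_snd (ofPair L P)).1, ← (toPair_fst_snd (ofPair L P)).2, toPair_ofPair]
  exact ⟨h1, h2⟩

/-- `toPair` of an odd complex class has odd components. [folklore] -/
theorem toPair_mem_Wodd {G : Wc L} (hG : G ∈ Wcodd L) : (toPair L G).fst ∈ Wodd L ∧ (toPair L G).snd ∈ Wodd L := by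
  rw [(toPair_fst_snd G).1, (toPair_fst_snd G).2]; exact (mem_Wcodd_iff L G).1 hG

variable {L}

/-! ### §3 Energy-space profiles are odd -/

/-- **Energy-space profiles are odd**: `ιE p ∈ Wodd L` for every `p ∈ Esp L`. [folklore] -/
theorem ιE_mem_Wodd (hL : 0 < L) (p : Esp L hL) : ιE hL p ∈ Wodd L := by
  rw [mem_Wodd_iff_ae L hL]
  obtain ⟨-, hodd, -, -, -, -, -⟩ := energyClass_of_mem hL p
  have h1 := ιE_ae hL p
  have h2 := (Measure.measurePreserving_neg (volume : Measure ℝ)).quasiMeasurePreserving.ae_eq_comp h1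
  filter_upwards [h1, h2] with y hy1 hy2
  rw [Function.comp_apply, Function.comp_apply] at hy2
  rw [hy2, hy1]
  exact hodd y

/-- `ofPair (ιpair P) ∈ Wcodd L` for every energy-space pair `P`. [folklore] -/
theorem ofPair_ιpair_mem_Wcodd (hL : 0 < L) (P : WithLp 2 (Esp L hL × Esp L hL)) : ofPair L (ιpair hL P) ∈ Wcodd L := by
  obtain ⟨h1, h2⟩ := ιpair_fst_snd hL P
  exact ofPair_mem_Wcodd L (by rw [h1]; exact ιE_mem_Wodd hL P.fst) (by rw [h2]; exact ιE_mem_Wodd hL P.snd)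

/-! ### §4 The density lemma: an odd class orthogonal to all odd tests vanishes -/

/-- The integral of an a.e.-odd function over `ℝ` vanishes. [folklore] -/
theorem integral_eq_zero_of_ae_odd {F : ℝ → ℝ} (h : (fun y => F (-y)) =ᵐ[volume] fun y => -F y) : ∫ y, F y = 0 := by
  have h1 : ∫ y, F (-y) = ∫ y, F y := integral_neg_eq_self F volume
  have h2 : ∫ y, F (-y) = ∫ y, -F y := integral_congr_ae h
  rw [integral_neg] at h2
  linarith

/-- The odd part of a `C¹` compactly supported function, with its derivative, is a compactly supported odd energy-class test. [folklore] -/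
theorem isCompactTest_oddPart {ψ : ℝ → ℝ} (hψ : ContDiff ℝ 1 ψ) (hsupp : HasCompactSupport ψ) :
    IsCompactTest (fun x => (ψ x - ψ (-x)) / 2) (deriv fun x => (ψ x - ψ (-x)) / 2) := by
  set φ : ℝ → ℝ := fun x => (ψ x - ψ (-x)) / 2 with hφ
  have hφC : ContDiff ℝ 1 φ := (hψ.sub (hψ.comp contDiff_neg)).div_const 2
  have hφd : ∀ x, HasDerivAt φ (deriv φ x) x := fun x => (hφC.differentiable one_ne_zero x).hasDerivAt
  have hcont : Continuous (deriv φ) := hφC.continuous_deriv le_rfl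
  -- compact support of `ψ` inside a ball
  obtain ⟨R, hR⟩ := (hsupp.isCompact).isBounded.subset_closedBall 0
  have hzero : ∀ x, R < |x| → ψ x = 0 := fun x hx =>
    image_eq_zero_of_notMem_tsupport fun hmem => by
      have := hR hmem
      rw [Metric.mem_closedBall, dist_zero_right, Real.norm_eq_abs] at this
      linarith
  have hφzero : ∀ x, R < |x| → φ x = 0 := fun x hx => by
    have h1 := hzero x hx
    have h2 := hzero (-x) (by rwa [abs_neg])
    simp only [hφ, h1, h2, sub_zero, zero_div]
  have hφderiv_zero : ∀ x, R + 1 ≤ |x| → deriv φ x = 0 := by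
    intro x hx
    have hev : φ =ᶠ[𝓝 x] fun _ => (0:ℝ) := by
      have : ∀ᶠ y in 𝓝 x, R < |y| := continuous_abs.continuousAt.eventually (lt_mem_nhds (by linarith))
      exact this.mono fun y hy => hφzero y hy
    rw [hev.deriv_eq, deriv_const]
  have hφsupp : HasCompactSupport (deriv φ) := by
    refine HasCompactSupport.intro (isCompact_closedBall (0:ℝ) (R + 1)) fun x hx => hφderiv_zero x ?_
    rw [Metric.mem_closedBall, dist_zero_right, Real.norm_eq_abs, not_le] at hx
    exact hx.le
  refine ⟨fun x => ?_, fun y => ?_, hcont.memLp_of_hasCompactSupport hφsupp,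
    ⟨R + 1, fun x hx => ⟨hφzero x (by linarith), hφderiv_zero x hx⟩⟩⟩
  · rw [intervalIntegral.integral_eq_sub_of_hasDerivAt (fun y _ => hφd y) (hcont.intervalIntegrable _ _)]
    ring
  · simp only [hφ, neg_neg]; ring

/-- Local integrability of `w·g` for `g ∈ L²_w`. [folklore] -/
theorem locallyIntegrable_weight_mul (hL : 0 < L) (g : W L) :
    LocallyIntegrable (fun y => (L ^ 2 + y ^ 2) * (g : ℝ → ℝ) y) volume := by
  have hw : LocallyIntegrable (fun y : ℝ => L ^ 2 + y ^ 2) volume := (by fun_prop : Continuous fun y : ℝ => L ^ 2 + y ^ 2).locallyIntegrable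
  have hsq := (weightedSq_of_W hL g).locallyIntegrable
  refine (hw.add hsq).mono (((by fun_prop : Continuous fun y : ℝ => L ^ 2 + y ^ 2).aestronglyMeasurable).mul
    (aestronglyMeasurable_of_W hL g)) (Eventually.of_forall fun y => ?_)
  have hw0 : 0 ≤ L ^ 2 + y ^ 2 := by positivity
  simp only [Pi.add_apply, Real.norm_eq_abs]
  rw [abs_mul, abs_of_nonneg hw0, abs_of_nonneg (by positivity : 0 ≤ L ^ 2 + y ^ 2 + (L ^ 2 + y ^ 2) * (g : ℝ → ℝ) y ^ 2)]
  nlinarith [mul_nonneg hw0 (sq_nonneg (|(g : ℝ → ℝ) y| - 1)), sq_abs ((g : ℝ → ℝ) y), abs_nonneg ((g : ℝ → ℝ) y)]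

/-- **The density lemma.**  If `g ∈ Wodd L` and `∫ w g v = 0` for every compactly supported odd energy-class test `(v, v₁)`, then `g = 0`:
the odd part of a smooth bump is such a test, the even part pairs to zero against the odd `w·g`, so `w·g` annihilates `C_c^∞` and
vanishes a.e. [folklore] -/
theorem eq_zero_of_mem_Wodd (hL : 0 < L) {g : W L} (hg : g ∈ Wodd L)
    (h : ∀ v v₁ : ℝ → ℝ, IsCompactTest v v₁ → ∫ y, (L ^ 2 + y ^ 2) * ((g : ℝ → ℝ) y * v y) = 0) : g = 0 := by
  rw [mem_Wodd_iff_ae L hL] at hg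
  have hloc := locallyIntegrable_weight_mul hL g
  have hae : ∀ᵐ y ∂volume, (L ^ 2 + y ^ 2) * (g : ℝ → ℝ) y = 0 := by
    refine ae_eq_zero_of_integral_contDiff_smul_eq_zero hloc fun ψ hψ hsupp => ?_
    -- split `ψ` into odd and even parts
    have hψ1 : ContDiff ℝ 1 ψ := hψ.of_le (by exact_mod_cast le_top)
    have htest := isCompactTest_oddPart hψ1 hsupp
    have hodd := h _ _ htest
    have hψc : Continuous ψ := hψ.continuous
    have hψn : Continuous fun x => ψ (-x) := hψc.comp continuous_neg
    have hsuppn : HasCompactSupport fun x => ψ (-x) := hsupp.comp_homeomorph (Homeomorph.neg ℝ)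
    have hI1 : Integrable (fun y => ψ y • ((L ^ 2 + y ^ 2) * (g : ℝ → ℝ) y)) := hloc.integrable_smul_left_of_hasCompactSupport hψc hsupp
    have hI2 : Integrable (fun y => ψ (-y) • ((L ^ 2 + y ^ 2) * (g : ℝ → ℝ) y)) :=
      hloc.integrable_smul_left_of_hasCompactSupport hψn hsuppn
    have hIo : Integrable (fun y => ((ψ y - ψ (-y)) / 2) • ((L ^ 2 + y ^ 2) * (g : ℝ → ℝ) y)) :=
      ((hI1.sub hI2).div_const 2).congr (Eventually.of_forall fun y => by simp only [smul_eq_mul, Pi.sub_apply]; ring)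
    have hIe : Integrable (fun y => ((ψ y + ψ (-y)) / 2) • ((L ^ 2 + y ^ 2) * (g : ℝ → ℝ) y)) :=
      ((hI1.add hI2).div_const 2).congr (Eventually.of_forall fun y => by simp only [smul_eq_mul, Pi.add_apply]; ring)
    have hsplit : (fun y => ψ y • ((L ^ 2 + y ^ 2) * (g : ℝ → ℝ) y)) = fun y =>
        ((ψ y - ψ (-y)) / 2) • ((L ^ 2 + y ^ 2) * (g : ℝ → ℝ) y) + ((ψ y + ψ (-y)) / 2) • ((L ^ 2 + y ^ 2) * (g : ℝ → ℝ) y) := by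
      funext y; simp only [smul_eq_mul]; ring
    rw [hsplit, integral_add hIo hIe]
    have h1 : ∫ y, ((ψ y - ψ (-y)) / 2) • ((L ^ 2 + y ^ 2) * (g : ℝ → ℝ) y) = 0 := by
      rw [← hodd]
      refine integral_congr_ae (Eventually.of_forall fun y => ?_)
      simp only [smul_eq_mul]; ring
    have h2 : ∫ y, ((ψ y + ψ (-y)) / 2) • ((L ^ 2 + y ^ 2) * (g : ℝ → ℝ) y) = 0 := by
      refine integral_eq_zero_of_ae_odd ?_
      filter_upwards [hg] with y hy
      simp only [smul_eq_mul, neg_neg, neg_sq, hy]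
      ring
    rw [h1, h2, add_zero]
  have hg0 : (g : ℝ → ℝ) =ᵐ[volume] 0 := by
    filter_upwards [hae] with y hy
    have hw : 0 < L ^ 2 + y ^ 2 := by positivity
    rcases mul_eq_zero.1 hy with h0 | h0
    · exact absurd h0 hw.ne'
    · exact h0
  exact (Lp.eq_zero_iff_ae_eq_zero).2 (ae_μw_of_ae_volume hg0)

/-- **The density lemma, complex form.**  If `G ∈ Wcodd L` and both `Re G` and `Im G` pair to zero against every compactly supported odd
energy-class test, then `G = 0`. [folklore] -/
theorem eq_zero_of_mem_Wcodd (hL : 0 < L) {G : Wc L} (hG : G ∈ Wcodd L)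
    (hre : ∀ v v₁ : ℝ → ℝ, IsCompactTest v v₁ → ∫ y, (L ^ 2 + y ^ 2) * (((reW L G : W L) : ℝ → ℝ) y * v y) = 0)
    (him : ∀ v v₁ : ℝ → ℝ, IsCompactTest v v₁ → ∫ y, (L ^ 2 + y ^ 2) * (((imW L G : W L) : ℝ → ℝ) y * v y) = 0) : G = 0 := by
  obtain ⟨h1, h2⟩ := (mem_Wcodd_iff L G).1 hG
  have e1 := eq_zero_of_mem_Wodd hL h1 hre
  have e2 := eq_zero_of_mem_Wodd hL h2 him
  rw [← ofPair_toPair G]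
  have h1' : (toPair L G).fst = (0 : WithLp 2 (W L × W L)).fst := by rw [(toPair_fst_snd G).1, e1, WithLp.zero_fst]
  have h2' : (toPair L G).snd = (0 : WithLp 2 (W L × W L)).snd := by rw [(toPair_fst_snd G).2, e2, WithLp.zero_snd]
  have : toPair L G = 0 := WithLp.ofLp_injective 2 (Prod.ext h1' h2')
  rw [this, map_zero]

end SheetROddClass
end Summit.NavierStokesRegularity.OSWSelfSimilar

end
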